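import Summits.QuantumAdvantage.AdviceFreeQNC0.BlockGame
import HarnessLib

/-!
# The block XOR game at `m = 2`: `V₂ ≤ 8/9` by COSET-BOX PARITY (the input of `RingLocalLt3`, ask P-18g)

Planner qa-qnc0-p1 g17–g19 (ROUND-16 §10: `V₂ = 8/9` by enumeration; ROUND-18 §6: the analytic certificate
"the number of winning cells in every coset box is EVEN"; ask P-18g: `RingLocalLt3` needs exactly
`9 * wins 2 τ ≤ 8 * total 2` on `BlockGame.lean`).  PROVED here for EVERY table profile `τ` (no enumeration of the
`4¹²` profiles): the admissible outcomes of the 2-block game are the transport pairs `(π₀, π₁)` of opposite signs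
(`d₀ = fix(π₁π₀)`, `d₁ = π₀ d₀`; `wins_two_eq`), they split into the two COSET BOXES `sign π₀ = ε, sign π₁ = −ε`
(9 cells each), and in each box the number of winning cells is EVEN (`box_wins_even`): WIN = [test₀ wrong] ⊕ [test₁ wrong],
and along every line of the box (one transport fixed, the other running over its coset) the fixed player's test is
fixed while its hidden residue runs over all of `ℤ/3`, so it is wrong an even number (0 or 2) of times
(`line_fst_even`, `line_snd_even`, `decide` over `S₃`).  Hence each box has a losing cell, `wins 2 τ ≤ 16 = (8/9)·18`
(**`blockGame_two`**; sharp: ROUND-16 kit j291830).  WHAT THIS IS NOT: `V₄ = 2/3` (P-17b) is not touched; instrument for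
the p = 3 local law; separation NOT moved.
-/

namespace Summit.QuantumAdvantage.AdviceFreeQNC0.BlockGame

open Finset Equiv

/-! ## §1 Finite facts about `S₃` acting on `ℤ/3` (all by `decide`) -/

/-- the fixed point of an odd permutation of `ℤ/3` (a reflection); junk on even ones. -/
def fixpt (σ : Perm (ZMod 3)) : ZMod 3 := if σ 0 = 0 then 0 else if σ 1 = 1 then 1 else 2

/-- a reflection fixes `fixpt`. -/
theorem fixpt_fixed : ∀ σ : Perm (ZMod 3), Perm.sign σ = -1 → σ (fixpt σ) = fixpt σ := by decide

/-- … and nothing else. -/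
theorem eq_fixpt : ∀ (σ : Perm (ZMod 3)) (d : ZMod 3), Perm.sign σ = -1 → σ d = d → d = fixpt σ := by decide

/-- tests take values `±1`. -/
theorem testVal_cases : ∀ (t : Fin 4) (d : ZMod 3), testVal t d = 1 ∨ testVal t d = -1 := by decide

/-- odd total sign ⟺ opposite signs. -/
theorem sign_mul_eq_neg_one_iff : ∀ a b : Perm (ZMod 3),
    Perm.sign a * Perm.sign b = -1 ↔ Perm.sign b = -Perm.sign a := by decide

/-- **line parity, first player**: with `π₀ = a` fixed and `π₁ = b` running over the opposite coset, the hidden residue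
`d₀ = fix(b a)` runs over all of `ℤ/3`, so a fixed test is wrong an even number of times. -/
theorem line_fst_even : ∀ (t : Fin 4) (a : Perm (ZMod 3)),
    (univ.filter fun b : Perm (ZMod 3) =>
      Perm.sign b = -Perm.sign a ∧ testVal t (fixpt (b * a)) = -1).card % 2 = 0 := by decide

/-- **line parity, second player**: with `π₁ = b` fixed and `π₀ = a` running over the opposite coset, `d₁ = a (fix(b a))`
runs over all of `ℤ/3`. -/
theorem line_snd_even : ∀ (t : Fin 4) (b : Perm (ZMod 3)),
    (univ.filter fun a : Perm (ZMod 3) =>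
      Perm.sign a = -Perm.sign b ∧ testVal t (a (fixpt (b * a))) = -1).card % 2 = 0 := by decide

/-- a coset box has 9 cells. -/
theorem card_box : ∀ ε : ℤˣ, (univ.filter fun ab : Perm (ZMod 3) × Perm (ZMod 3) =>
      Perm.sign ab.1 = ε ∧ Perm.sign ab.2 = -ε).card = 9 := by decide

/-- `total 1 = 3` (the three reflections). -/
theorem total_one : total 1 = 3 := by decide

/-- `total 2 = 18`. -/
theorem total_two : total 2 = 18 := by
  have h := total_succ 0
  simp only [Nat.zero_add] at h
  rw [h, total_one]

/-! ## §2 The admissible outcomes of the 2-block game are the opposite-sign transport pairs -/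

/-- WIN at the transport pair `(a, b) = (π₀, π₁)`: `d₀ = fix(b a)`, `d₁ = a d₀`. -/
abbrev PairWin (τ : Fin 2 → Perm (ZMod 3) → Fin 4) (a b : Perm (ZMod 3)) : Prop :=
  testVal (τ 0 a) (fixpt (b * a)) * testVal (τ 1 b) (a (fixpt (b * a))) = -1

/-- `#{(a,b) | P a b} = Σ_b #{a | P a b}` (fibres over the second coordinate). -/
theorem card_filter_prod_eq_sum_snd {α β : Type*} [Fintype α] [Fintype β] (P : α → β → Prop)
    [∀ a, DecidablePred (P a)] :
    (univ.filter fun x : α × β => P x.1 x.2).card = ∑ b, (univ.filter fun a => P a b).card := by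
  rw [Finset.card_filter, Fintype.sum_prod_type_right]
  simp only [Finset.card_filter]

/-- validity at `m = 2`, unfolded. -/
theorem valid_two_iff (d : Fin 2 → ZMod 3) (π : Fin 2 → Perm (ZMod 3)) :
    Valid 2 d π ↔ (π 0 (d 0) = d 1 ∧ π 1 (d 1) = d 0) ∧ Perm.sign (π 0) * Perm.sign (π 1) = -1 := by
  unfold Valid
  rw [Fin.prod_univ_two, Fin.forall_fin_two]
  have h1 : (1 : Fin 2) + 1 = 0 := by decide
  rw [h1, zero_add]

/-- **`wins 2 τ` counted over transport pairs.** -/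
theorem wins_two_eq (τ : Fin 2 → Perm (ZMod 3) → Fin 4) :
    wins 2 τ = (univ.filter fun ab : Perm (ZMod 3) × Perm (ZMod 3) =>
      Perm.sign ab.2 = -Perm.sign ab.1 ∧ PairWin τ ab.1 ab.2).card := by
  unfold wins
  refine card_nbij' (fun o : (Fin 2 → ZMod 3) × (Fin 2 → Perm (ZMod 3)) => (o.2 0, o.2 1))
    (fun ab : Perm (ZMod 3) × Perm (ZMod 3) => (![fixpt (ab.2 * ab.1), ab.1 (fixpt (ab.2 * ab.1))], ![ab.1, ab.2]))
    ?_ ?_ ?_ ?_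
  · rintro ⟨d, π⟩ ho
    simp only [coe_filter, mem_univ, true_and, Set.mem_setOf_eq, valid_two_iff] at ho ⊢
    obtain ⟨⟨⟨h01, h10⟩, hs⟩, hpay⟩ := ho
    have hs' : Perm.sign (π 1) = -Perm.sign (π 0) := (sign_mul_eq_neg_one_iff _ _).mp hs
    have hodd : Perm.sign (π 1 * π 0) = -1 := by
      rw [map_mul, hs']; simp [Int.units_mul_self]
    have hd0 : d 0 = fixpt (π 1 * π 0) := eq_fixpt _ _ hodd (by rw [Perm.mul_apply, h01, h10])
    refine ⟨hs', ?_⟩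
    unfold PairWin
    rw [← hd0, h01]
    unfold payoff at hpay
    rwa [Fin.prod_univ_two] at hpay
  · rintro ⟨a, b⟩ hab
    simp only [coe_filter, mem_univ, true_and, Set.mem_setOf_eq] at hab ⊢
    obtain ⟨hs, hwin⟩ := hab
    have hodd : Perm.sign (b * a) = -1 := by rw [map_mul, hs]; simp [Int.units_mul_self]
    refine ⟨(valid_two_iff _ _).mpr ⟨⟨?_, ?_⟩, ?_⟩, ?_⟩
    · simp
    · simp only [Matrix.cons_val_one, Matrix.cons_val_zero]
      rw [← Perm.mul_apply, fixpt_fixed _ hodd]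
    · simp only [Matrix.cons_val_zero, Matrix.cons_val_one]
      exact (sign_mul_eq_neg_one_iff _ _).mpr hs
    · unfold payoff
      rw [Fin.prod_univ_two]
      simpa [PairWin] using hwin
  · rintro ⟨d, π⟩ ho
    simp only [coe_filter, mem_univ, true_and, Set.mem_setOf_eq, valid_two_iff] at ho
    obtain ⟨⟨⟨h01, h10⟩, hs⟩, -⟩ := ho
    have hs' : Perm.sign (π 1) = -Perm.sign (π 0) := (sign_mul_eq_neg_one_iff _ _).mp hs
    have hodd : Perm.sign (π 1 * π 0) = -1 := by rw [map_mul, hs']; simp [Int.units_mul_self]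
    have hd0 : d 0 = fixpt (π 1 * π 0) := eq_fixpt _ _ hodd (by rw [Perm.mul_apply, h01, h10])
    simp only [Prod.mk.injEq]
    constructor
    · funext i; fin_cases i
      · simp [hd0]
      · simp [← hd0, h01]
    · funext i; fin_cases i <;> simp
  · rintro ⟨a, b⟩ _
    simp

/-! ## §3 Coset-box parity -/

/-- the winning cells of the box `sign π₀ = ε`, `sign π₁ = −ε`. -/
noncomputable def boxWins (τ : Fin 2 → Perm (ZMod 3) → Fin 4) (ε : ℤˣ) : ℕ :=
  (univ.filter fun ab : Perm (ZMod 3) × Perm (ZMod 3) =>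
      (Perm.sign ab.1 = ε ∧ Perm.sign ab.2 = -ε) ∧ PairWin τ ab.1 ab.2).card

/-- the two boxes exhaust the admissible pairs. -/
theorem wins_two_eq_boxes (τ : Fin 2 → Perm (ZMod 3) → Fin 4) : wins 2 τ = boxWins τ 1 + boxWins τ (-1) := by
  rw [wins_two_eq]
  unfold boxWins
  rw [← card_union_of_disjoint]
  · congr 1
    ext ⟨a, b⟩
    simp only [mem_filter, mem_univ, true_and, mem_union]
    rcases Int.units_eq_one_or (Perm.sign a) with h | h <;> simp [h]
  · rw [disjoint_filter]
    rintro ⟨a, b⟩ _ ⟨⟨h1, _⟩, _⟩ ⟨⟨h2, _⟩, _⟩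
    rw [h1] at h2; exact absurd h2 (by decide)

/-- WIN ⟺ exactly one of the two tests is wrong. -/
theorem pairWin_iff (τ : Fin 2 → Perm (ZMod 3) → Fin 4) (a b : Perm (ZMod 3)) :
    PairWin τ a b ↔ ¬ (testVal (τ 0 a) (fixpt (b * a)) = -1 ↔ testVal (τ 1 b) (a (fixpt (b * a))) = -1) := by
  unfold PairWin
  rcases testVal_cases (τ 0 a) (fixpt (b * a)) with h0 | h0 <;>
    rcases testVal_cases (τ 1 b) (a (fixpt (b * a))) with h1 | h1 <;> simp [h0, h1]

/-- **COSET-BOX PARITY**: the number of winning cells in each box is even. -/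
theorem box_wins_even (τ : Fin 2 → Perm (ZMod 3) → Fin 4) (ε : ℤˣ) : boxWins τ ε % 2 = 0 := by
  -- the two "one test wrong" counts over the box
  set A := (univ.filter fun ab : Perm (ZMod 3) × Perm (ZMod 3) =>
      (Perm.sign ab.1 = ε ∧ Perm.sign ab.2 = -ε) ∧ testVal (τ 0 ab.1) (fixpt (ab.2 * ab.1)) = -1).card with hA
  set B := (univ.filter fun ab : Perm (ZMod 3) × Perm (ZMod 3) =>
      (Perm.sign ab.1 = ε ∧ Perm.sign ab.2 = -ε) ∧ testVal (τ 1 ab.2) (ab.1 (fixpt (ab.2 * ab.1))) = -1).card with hB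
  set C := (univ.filter fun ab : Perm (ZMod 3) × Perm (ZMod 3) =>
      (Perm.sign ab.1 = ε ∧ Perm.sign ab.2 = -ε) ∧ (testVal (τ 0 ab.1) (fixpt (ab.2 * ab.1)) = -1
        ∧ testVal (τ 1 ab.2) (ab.1 (fixpt (ab.2 * ab.1))) = -1)).card with hC
  -- (i) boxWins + 2C = A + B
  have hsum : boxWins τ ε + 2 * C = A + B := by
    unfold boxWins
    rw [hA, hB, hC, card_filter, card_filter, card_filter, card_filter, mul_sum, ← sum_add_distrib, ← sum_add_distrib]
    refine sum_congr rfl fun ab _ => ?_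
    by_cases hbox : Perm.sign ab.1 = ε ∧ Perm.sign ab.2 = -ε
    · rcases testVal_cases (τ 0 ab.1) (fixpt (ab.2 * ab.1)) with h0 | h0 <;>
        rcases testVal_cases (τ 1 ab.2) (ab.1 (fixpt (ab.2 * ab.1))) with h1 | h1 <;>
          simp [PairWin, hbox, h0, h1]
    · simp [hbox]
  -- (ii) A is even: fibres over the first coordinate are lines of the box
  have hAe : A % 2 = 0 := by
    rw [hA, card_filter_prod_eq_sum (fun a b => (Perm.sign a = ε ∧ Perm.sign b = -ε)
      ∧ testVal (τ 0 a) (fixpt (b * a)) = -1), Finset.sum_nat_mod, Finset.sum_eq_zero, Nat.zero_mod]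
    intro a _
    by_cases ha : Perm.sign a = ε
    · have e : (univ.filter fun b : Perm (ZMod 3) => (Perm.sign a = ε ∧ Perm.sign b = -ε)
          ∧ testVal (τ 0 a) (fixpt (b * a)) = -1)
          = univ.filter fun b : Perm (ZMod 3) => Perm.sign b = -Perm.sign a ∧ testVal (τ 0 a) (fixpt (b * a)) = -1 := by
        congr 1; ext b; simp [ha]
      rw [e]; exact line_fst_even _ _
    · rw [filter_false_of_mem (fun b _ h => ha h.1.1)]; rfl
  -- (iii) B is even: fibres over the second coordinate
  have hBe : B % 2 = 0 := by
    rw [hB, card_filter_prod_eq_sum_snd (fun a b => (Perm.sign a = ε ∧ Perm.sign b = -ε)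
      ∧ testVal (τ 1 b) (a (fixpt (b * a))) = -1), Finset.sum_nat_mod, Finset.sum_eq_zero, Nat.zero_mod]
    intro b _
    by_cases hb : Perm.sign b = -ε
    · have e : (univ.filter fun a : Perm (ZMod 3) => (Perm.sign a = ε ∧ Perm.sign b = -ε)
          ∧ testVal (τ 1 b) (a (fixpt (b * a))) = -1)
          = univ.filter fun a : Perm (ZMod 3) => Perm.sign a = -Perm.sign b ∧ testVal (τ 1 b) (a (fixpt (b * a))) = -1 := by
        congr 1; ext a; simp [hb]
      rw [e]; exact line_snd_even _ _
    · rw [filter_false_of_mem (fun a _ h => hb h.1.2)]; rfl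
  omega

/-- each box has at most 8 winning cells (9 cells, even number of wins). -/
theorem boxWins_le (τ : Fin 2 → Perm (ZMod 3) → Fin 4) (ε : ℤˣ) : boxWins τ ε ≤ 8 := by
  have h9 : boxWins τ ε ≤ 9 := by
    unfold boxWins
    rw [← card_box ε]
    exact card_le_card (fun ab => by simp only [mem_filter, mem_univ, true_and]; exact fun h => h.1)
  have := box_wins_even τ ε
  omega

/-! ## §4 `V₂ ≤ 8/9` -/

/-- **`V₂ ≤ 8/9`**: every table profile of the 2-block game wins at most `16` of the `18` admissible outcomes
(the input `9 * wins 2 τ ≤ 8 * total 2` of `RingLocalLt3`, planner qa-qnc0-p1 ask P-18g; sharp by ROUND-16 §10). -/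
theorem blockGame_two (τ : Fin 2 → Perm (ZMod 3) → Fin 4) : 9 * wins 2 τ ≤ 8 * total 2 := by
  rw [wins_two_eq_boxes, total_two]
  have h1 := boxWins_le τ 1
  have h2 := boxWins_le τ (-1)
  omega

end Summit.QuantumAdvantage.AdviceFreeQNC0.BlockGame
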